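import Literature.MathematicalPhysics.QuantumLattice.WilsonDiracRangeOne
import Literature.Analysis.SpecialFunctions.GegenbauerExplicitODE
import Mathlib.Analysis.Matrix.HermitianFunctionalCalculus
import HarnessLib

/-!
# Tools for overlap-kernel estimates: taxi range, block norms, spectral series

Topic `Literature/MathematicalPhysics/QuantumLattice`; namespace `Literature.MathematicalPhysics.QuantumLattice`.
Generic, fully proved lemmas used to discharge the Hernández–Jansen–Lüscher locality fact `HJLLocality`
(`OverlapLocality.lean`; the discharge is in `OverlapLocalityProofs.lean`), on the fermion index
`TorusSite 4 L × Fin N × Fin 4` of the tree: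

* **taxi range** [HernandezJansenLuscher1999, (2.11)]: `torusTaxiDist_triangle`; if `A` vanishes beyond taxi
  distance `r` and `B` beyond `s` then `AB` vanishes beyond `r + s` (`mul_apply_eq_zero_of_taxiRange`), powers and
  real polynomials accordingly (`pow_apply_eq_zero_of_taxiRange`, `aeval_apply_eq_zero_of_taxiRange`); the Wilson
  matrix, its adjoint and `D_Wᴴ D_W` have ranges `1, 1, 2` (from `torusTaxiDist_le_one_of_wilsonDirac_ne_zero`);
* **block norms** (`ℓ²` operator norms, `open scoped Matrix.Norms.L2Operator`): `‖1‖ ≤ 1`, isometries have norm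
  `≤ 1`, the kernel block `siteBlock M x y` is the compression `R_x M R_yᴴ` by row selectors and hence
  `‖M(x,y)‖ ≤ ‖M‖` (`norm_siteBlock_le`), and `‖U diag(d) U⋆‖ ≤ sup |d_i|` for unitary `U`
  (`l2_opNorm_unitary_conj_diagonal_le`);
* **spectral input**: `Re⟨w, AᴴAw⟩ = Σ‖(Aw)_j‖²`; quadratic-form bounds `u‖ψ‖² ≤ ‖Aψ‖² ≤ v‖ψ‖²` put every
  eigenvalue of `AᴴA` in `[u, v]` (`eigenvalues_mem_Icc_of_quadratic_bounds`); and a series identity valid at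
  every eigenvalue, `Σ_k c_k f_k(λ_i) = g(λ_i)`, lifts to the functional calculus,
  `Σ_k c_k • cfc f_k A = cfc g A` (`hasSum_smul_cfc_of_hasSum_eigenvalues`, via `Matrix.IsHermitian.cfc_eq`);
* `exists_polynomial_gegenbauerSum_affine`: `s ↦ C_k^{(a)}(α + βs)` is a real polynomial of degree `≤ k`.

No definitions, no named facts.

## References
* P. Hernández, K. Jansen, M. Lüscher, Nucl. Phys. B 552 (1999) 363–378, arXiv:hep-lat/9808010, §2.2 (2.11). [HernandezJansenLuscher1999]
-/

noncomputable section

open Matrix Finset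
open Literature.Probability.LatticeModels (TorusSite)
open Literature.MathematicalPhysics.QuantumFieldTheory

namespace Literature.MathematicalPhysics.QuantumLattice

/-! ### Finite range in the taxi distance -/

section Range

variable {L N : ℕ} [NeZero L]

/-- Triangle inequality for the periodic taxi-driver distance. [folklore] -/
theorem torusTaxiDist_triangle {d : ℕ} (x y z : TorusSite d L) :
    torusTaxiDist x z ≤ torusTaxiDist x y + torusTaxiDist y z :=
  torusDistOne_triangle (Ls := fun _ : Fin d => L) x y z

/-- **Ranges add under products**: if `A` vanishes beyond taxi distance `r` and `B` beyond `s`,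
then `A B` vanishes beyond `r + s`. [cite: HernandezJansenLuscher1999, (2.11) (the argument)] -/
theorem mul_apply_eq_zero_of_taxiRange
    {A B : Matrix (TorusSite 4 L × Fin N × Fin 4) (TorusSite 4 L × Fin N × Fin 4) ℂ} {r s : ℕ}
    (hA : ∀ p q, r < torusTaxiDist p.1 q.1 → A p q = 0)
    (hB : ∀ p q, s < torusTaxiDist p.1 q.1 → B p q = 0)
    (p q : TorusSite 4 L × Fin N × Fin 4) (h : r + s < torusTaxiDist p.1 q.1) : (A * B) p q = 0 := by
  rw [Matrix.mul_apply]
  refine Finset.sum_eq_zero fun o _ => ?_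
  by_cases h1 : r < torusTaxiDist p.1 o.1
  · rw [hA p o h1, zero_mul]
  · have h2 : s < torusTaxiDist o.1 q.1 := by
      have := torusTaxiDist_triangle p.1 o.1 q.1
      omega
    rw [hB o q h2, mul_zero]

/-- Powers: `A^i` vanishes beyond taxi distance `i r`. [folklore] -/
theorem pow_apply_eq_zero_of_taxiRange
    {A : Matrix (TorusSite 4 L × Fin N × Fin 4) (TorusSite 4 L × Fin N × Fin 4) ℂ} {r : ℕ}
    (hA : ∀ p q, r < torusTaxiDist p.1 q.1 → A p q = 0) :
    ∀ (i : ℕ) (p q : TorusSite 4 L × Fin N × Fin 4), i * r < torusTaxiDist p.1 q.1 → (A ^ i) p q = 0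
  | 0 => by
    intro p q h
    rw [pow_zero, Matrix.one_apply]
    split_ifs with hpq
    · subst hpq; simp at h
    · rfl
  | (i + 1) => by
    intro p q h
    rw [pow_succ]
    exact mul_apply_eq_zero_of_taxiRange (pow_apply_eq_zero_of_taxiRange hA i) hA p q
      (by rw [Nat.succ_mul] at h; exact h)

/-- Polynomials: `f(A)` vanishes beyond taxi distance `(deg f) r`. [folklore] -/
theorem aeval_apply_eq_zero_of_taxiRange
    {A : Matrix (TorusSite 4 L × Fin N × Fin 4) (TorusSite 4 L × Fin N × Fin 4) ℂ} {r : ℕ}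
    (hA : ∀ p q, r < torusTaxiDist p.1 q.1 → A p q = 0) (f : Polynomial ℝ)
    (p q : TorusSite 4 L × Fin N × Fin 4) (h : f.natDegree * r < torusTaxiDist p.1 q.1) :
    (Polynomial.aeval A f) p q = 0 := by
  rw [Polynomial.aeval_eq_sum_range, Matrix.sum_apply]
  refine Finset.sum_eq_zero fun i hi => ?_
  rw [Finset.mem_range] at hi
  have hi' : i * r ≤ f.natDegree * r := Nat.mul_le_mul_right r (by omega)
  rw [Matrix.smul_apply, pow_apply_eq_zero_of_taxiRange hA i p q (lt_of_le_of_lt hi' h), smul_zero]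

variable {G : Type*} [Group G] (ρ : G →* Matrix (Fin N) (Fin N) ℂ)

/-- The Wilson–Dirac matrix vanishes beyond taxi distance `1`. [cite: HernandezJansenLuscher1999, §3.1] -/
theorem wilsonDirac_apply_eq_zero_of_one_lt (hρ : ∀ g, ρ g ∈ Matrix.unitaryGroup (Fin N) ℂ)
    (U : GaugeConfig 4 L G) (m : ℝ) (p q : TorusSite 4 L × Fin N × Fin 4)
    (h : 1 < torusTaxiDist p.1 q.1) : wilsonDirac ρ U m 1 p q = 0 := by
  by_contra hne
  have := torusTaxiDist_le_one_of_wilsonDirac_ne_zero ρ hρ U m p q hne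
  omega

/-- Its adjoint vanishes beyond taxi distance `1` as well. [folklore] -/
theorem wilsonDirac_conjTranspose_apply_eq_zero_of_one_lt
    (hρ : ∀ g, ρ g ∈ Matrix.unitaryGroup (Fin N) ℂ)
    (U : GaugeConfig 4 L G) (m : ℝ) (p q : TorusSite 4 L × Fin N × Fin 4)
    (h : 1 < torusTaxiDist p.1 q.1) : (wilsonDirac ρ U m 1)ᴴ p q = 0 := by
  rw [conjTranspose_apply, wilsonDirac_apply_eq_zero_of_one_lt ρ hρ U m q p
    (by rwa [torusTaxiDist_comm]), star_zero]

/-- `A†A = D_Wᴴ D_W` vanishes beyond taxi distance `2`. [cite: HernandezJansenLuscher1999, (2.11)] -/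
theorem conjTranspose_mul_wilsonDirac_apply_eq_zero_of_two_lt
    (hρ : ∀ g, ρ g ∈ Matrix.unitaryGroup (Fin N) ℂ)
    (U : GaugeConfig 4 L G) (m : ℝ) (p q : TorusSite 4 L × Fin N × Fin 4)
    (h : 2 < torusTaxiDist p.1 q.1) : ((wilsonDirac ρ U m 1)ᴴ * wilsonDirac ρ U m 1) p q = 0 :=
  mul_apply_eq_zero_of_taxiRange (wilsonDirac_conjTranspose_apply_eq_zero_of_one_lt ρ hρ U m)
    (wilsonDirac_apply_eq_zero_of_one_lt ρ hρ U m) p q h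

end Range

/-! ### Operator-norm bookkeeping -/

section Norms

open scoped Matrix.Norms.L2Operator

variable {L N : ℕ} [NeZero L]

/-- `‖1‖ ≤ 1` in the `ℓ²` operator norm. [folklore] -/
theorem l2_opNorm_one_le {k : Type*} [Fintype k] [DecidableEq k] : ‖(1 : Matrix k k ℂ)‖ ≤ 1 := by
  rw [← diagonal_one, Matrix.l2_opNorm_diagonal]
  refine (pi_norm_le_iff_of_nonneg zero_le_one).mpr fun i => ?_
  simp

/-- A matrix with `Pᴴ P = 1` (an isometry) has operator norm `≤ 1`. [folklore] -/
theorem l2_opNorm_le_one_of_conjTranspose_mul_self {m k : Type*} [Fintype m] [DecidableEq m]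
    [Fintype k] [DecidableEq k] (P : Matrix m k ℂ) (h : Pᴴ * P = 1) : ‖P‖ ≤ 1 := by
  have h1 := Matrix.l2_opNorm_conjTranspose_mul_self P
  rw [h] at h1
  have h2 : ‖P‖ * ‖P‖ ≤ 1 := h1 ▸ l2_opNorm_one_le
  nlinarith [norm_nonneg P]

/-- The row selector of the site `x`: `R_x = 1.submatrix (x, ·) id`; `R_x R_xᴴ = 1`. [folklore] -/
theorem rowSel_mul_conjTranspose (x : TorusSite 4 L) :
    (1 : Matrix (TorusSite 4 L × Fin N × Fin 4) (TorusSite 4 L × Fin N × Fin 4) ℂ).submatrix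
        (Prod.mk x) id *
      ((1 : Matrix (TorusSite 4 L × Fin N × Fin 4) (TorusSite 4 L × Fin N × Fin 4) ℂ).submatrix
        (Prod.mk x) id)ᴴ = 1 := by
  ext i j
  rw [Matrix.mul_apply, Finset.sum_eq_single (x, i)]
  · simp [Matrix.one_apply, Prod.ext_iff, eq_comm]
  · intro b _ hb
    simp [Matrix.one_apply, Ne.symm hb]
  · simp

/-- The kernel block is a compression: `M(x,y) = R_x M R_yᴴ`. [folklore] -/
theorem siteBlock_eq_rowSel_mul (M : Matrix (TorusSite 4 L × Fin N × Fin 4)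
    (TorusSite 4 L × Fin N × Fin 4) ℂ) (x y : TorusSite 4 L) :
    siteBlock M x y =
      (1 : Matrix (TorusSite 4 L × Fin N × Fin 4) (TorusSite 4 L × Fin N × Fin 4) ℂ).submatrix
          (Prod.mk x) id * M *
        ((1 : Matrix (TorusSite 4 L × Fin N × Fin 4) (TorusSite 4 L × Fin N × Fin 4) ℂ).submatrix
          (Prod.mk y) id)ᴴ := by
  ext i j
  rw [siteBlock_apply, Matrix.mul_apply, Finset.sum_eq_single (y, j)]
  · rw [Matrix.mul_apply, Finset.sum_eq_single (x, i)]
    · simp [Matrix.one_apply]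
    · intro b _ hb
      simp [Ne.symm hb]
    · simp
  · intro c _ hc
    simp [Ne.symm hc]
  · simp

/-- **A kernel block is bounded by the operator norm**: `‖M(x,y)‖ ≤ ‖M‖`. [folklore] -/
theorem norm_siteBlock_le (M : Matrix (TorusSite 4 L × Fin N × Fin 4)
    (TorusSite 4 L × Fin N × Fin 4) ℂ) (x y : TorusSite 4 L) : ‖siteBlock M x y‖ ≤ ‖M‖ := by
  set R : TorusSite 4 L → Matrix (Fin N × Fin 4) (TorusSite 4 L × Fin N × Fin 4) ℂ := fun z =>
    (1 : Matrix (TorusSite 4 L × Fin N × Fin 4) (TorusSite 4 L × Fin N × Fin 4) ℂ).submatrix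
      (Prod.mk z) id with hRdef
  have hR : ∀ z : TorusSite 4 L, ‖R z‖ ≤ 1 := by
    intro z
    rw [← Matrix.l2_opNorm_conjTranspose]
    refine l2_opNorm_le_one_of_conjTranspose_mul_self _ ?_
    rw [conjTranspose_conjTranspose]
    exact rowSel_mul_conjTranspose z
  have hblock : siteBlock M x y = R x * M * (R y)ᴴ := siteBlock_eq_rowSel_mul M x y
  rw [hblock]
  calc ‖R x * M * (R y)ᴴ‖ ≤ ‖R x * M‖ * ‖(R y)ᴴ‖ := Matrix.l2_opNorm_mul _ _
    _ ≤ (‖R x‖ * ‖M‖) * 1 := by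
        refine mul_le_mul (Matrix.l2_opNorm_mul _ _) ?_ (norm_nonneg _) (by positivity)
        rw [Matrix.l2_opNorm_conjTranspose]; exact hR y
    _ ≤ (1 * ‖M‖) * 1 := by gcongr; exact hR x
    _ = ‖M‖ := by ring

/-- The conjugation `U diag(d) U⋆` by a unitary has operator norm `≤ sup |d_i|`. [folklore] -/
theorem l2_opNorm_unitary_conj_diagonal_le {n : Type*} [Fintype n] [DecidableEq n]
    (U : Matrix n n ℂ) (hU : U ∈ Matrix.unitaryGroup n ℂ) (d : n → ℂ) {c : ℝ} (hc : 0 ≤ c)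
    (hd : ∀ i, ‖d i‖ ≤ c) : ‖U * diagonal d * star U‖ ≤ c := by
  have hU1 : ‖U‖ ≤ 1 :=
    l2_opNorm_le_one_of_conjTranspose_mul_self U (Matrix.mem_unitaryGroup_iff'.mp hU)
  have hU2 : ‖star U‖ ≤ 1 := by
    rw [star_eq_conjTranspose, Matrix.l2_opNorm_conjTranspose]; exact hU1
  have hD : ‖diagonal d‖ ≤ c := by
    rw [Matrix.l2_opNorm_diagonal]
    exact (pi_norm_le_iff_of_nonneg hc).mpr hd
  calc ‖U * diagonal d * star U‖ ≤ ‖U * diagonal d‖ * ‖star U‖ := Matrix.l2_opNorm_mul _ _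
    _ ≤ (‖U‖ * ‖diagonal d‖) * 1 :=
        mul_le_mul (Matrix.l2_opNorm_mul _ _) hU2 (norm_nonneg _) (by positivity)
    _ ≤ (1 * c) * 1 := by gcongr
    _ = c := by ring

end Norms


/-! ### Spectral input: eigenvalue bounds and series through the spectral decomposition -/

section Spectral

variable {n : Type*} [Fintype n] [DecidableEq n]

omit [DecidableEq n] in
/-- The quadratic form of `AᴴA`: `Re ⟨w, AᴴA w⟩ = Σ_j ‖(Aw)_j‖²`. [folklore] -/
theorem re_star_dotProduct_conjTranspose_mul_self_mulVec (A : Matrix n n ℂ) (w : n → ℂ) :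
    RCLike.re (star w ⬝ᵥ (Aᴴ * A) *ᵥ w) = ∑ j, ‖(A *ᵥ w) j‖ ^ 2 := by
  rw [← Matrix.mulVec_mulVec, Matrix.dotProduct_mulVec, Matrix.vecMul_conjTranspose, star_star]
  simp only [dotProduct, Pi.star_apply, RCLike.star_def, map_sum, RCLike.conj_mul, ← RCLike.ofReal_pow,
    RCLike.ofReal_re]

/-- **Quadratic-form bounds pin the spectrum**: if `u‖ψ‖² ≤ ‖Aψ‖² ≤ v‖ψ‖²` for all `ψ` then every
eigenvalue of `AᴴA` lies in `[u, v]`. [folklore] -/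
theorem eigenvalues_mem_Icc_of_quadratic_bounds (A : Matrix n n ℂ) {u v : ℝ}
    (hlow : ∀ ψ : n → ℂ, u * ∑ i, ‖ψ i‖ ^ 2 ≤ ∑ i, ‖(A *ᵥ ψ) i‖ ^ 2)
    (hup : ∀ ψ : n → ℂ, ∑ i, ‖(A *ᵥ ψ) i‖ ^ 2 ≤ v * ∑ i, ‖ψ i‖ ^ 2)
    (hQ : (Aᴴ * A).IsHermitian) (i : n) : u ≤ hQ.eigenvalues i ∧ hQ.eigenvalues i ≤ v := by
  have h1 := hQ.eigenvalues_eq i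
  rw [re_star_dotProduct_conjTranspose_mul_self_mulVec] at h1
  have hnorm : ∑ j, ‖(⇑(hQ.eigenvectorBasis i) : n → ℂ) j‖ ^ 2 = 1 := by
    have h2 := hQ.eigenvectorBasis.orthonormal.1 i
    rw [EuclideanSpace.norm_eq, Real.sqrt_eq_one] at h2
    exact h2
  have hl := hlow (⇑(hQ.eigenvectorBasis i))
  have hu' := hup (⇑(hQ.eigenvectorBasis i))
  rw [hnorm, mul_one, ← h1] at hl hu'
  exact ⟨hl, hu'⟩

/-- **Series through the spectral decomposition**: if `Σ_k c_k f_k(λ) = g(λ)` at every eigenvalue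
`λ` of the Hermitian matrix `A`, then `Σ_k c_k f_k(A) = g(A)` in the functional calculus. [folklore] -/
theorem hasSum_smul_cfc_of_hasSum_eigenvalues {A : Matrix n n ℂ} (hA : A.IsHermitian)
    (f : ℕ → ℝ → ℝ) (g : ℝ → ℝ) (c : ℕ → ℝ)
    (h : ∀ i, HasSum (fun k => c k * f k (hA.eigenvalues i)) (g (hA.eigenvalues i))) :
    HasSum (fun k => ((c k : ℝ) : ℂ) • cfc (f k) A) (cfc g A) := by
  simp_rw [hA.cfc_eq, Matrix.IsHermitian.cfc, Unitary.conjStarAlgAut_apply]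
  have hdiag : HasSum (fun k => diagonal (fun i => (((c k * f k (hA.eigenvalues i) : ℝ)) : ℂ)))
      (diagonal (RCLike.ofReal ∘ g ∘ hA.eigenvalues)) := by
    apply HasSum.matrix_diagonal
    rw [Pi.hasSum]
    intro i
    simp only [Function.comp_apply]
    exact (Complex.hasSum_ofReal).mpr (h i)
  have h2 := (hdiag.mul_left (hA.eigenvectorUnitary : Matrix n n ℂ)).mul_right
    (star (hA.eigenvectorUnitary : Matrix n n ℂ))
  have hfun : (fun k : ℕ => ((c k : ℝ) : ℂ) • ((hA.eigenvectorUnitary : Matrix n n ℂ) *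
      diagonal (RCLike.ofReal ∘ f k ∘ hA.eigenvalues) * star (hA.eigenvectorUnitary : Matrix n n ℂ))) =
      fun k : ℕ => (hA.eigenvectorUnitary : Matrix n n ℂ) *
        diagonal (fun i => (((c k * f k (hA.eigenvalues i) : ℝ)) : ℂ)) *
          star (hA.eigenvectorUnitary : Matrix n n ℂ) := by
    funext k
    rw [← smul_mul_assoc, ← mul_smul_comm, ← Matrix.diagonal_smul]
    have hd : ((c k : ℝ) : ℂ) • (RCLike.ofReal ∘ f k ∘ hA.eigenvalues : n → ℂ) =
        fun i => (((c k * f k (hA.eigenvalues i) : ℝ)) : ℂ) := by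
      funext i
      simp only [Pi.smul_apply, Function.comp_apply, smul_eq_mul, Complex.ofReal_mul]
      rfl
    rw [hd]
  rw [hfun]
  exact h2

end Spectral

/-! ### The Legendre polynomial of an affine function is a polynomial of the same degree -/

section Poly

open Polynomial Literature.Analysis.SpecialFunctions

/-- `s ↦ C_k^{(a)}(α + β s)` is a real polynomial of degree `≤ k`. [folklore] -/
theorem exists_polynomial_gegenbauerSum_affine (a : ℝ) (k : ℕ) (α β : ℝ) :
    ∃ q : ℝ[X], q.natDegree ≤ k ∧ ∀ s, q.eval s = gegenbauerSum a k (α + β * s) := by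
  refine ⟨∑ l ∈ Finset.range (k / 2 + 1),
    C (gegenbauerCoeff a k l) * (C 2 * (C α + C β * X)) ^ (k - 2 * l), ?_, ?_⟩
  · refine Polynomial.natDegree_sum_le_of_forall_le _ _ fun l _ => ?_
    refine (Polynomial.natDegree_C_mul_le _ _).trans ?_
    refine (Polynomial.natDegree_pow_le).trans ?_
    have h1 : (C 2 * (C α + C β * X) : ℝ[X]).natDegree ≤ 1 := by
      refine (Polynomial.natDegree_C_mul_le _ _).trans ?_
      refine (Polynomial.natDegree_add_le _ _).trans ?_
      rw [max_le_iff]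
      exact ⟨(Polynomial.natDegree_C α).le.trans zero_le_one,
        (Polynomial.natDegree_C_mul_le _ _).trans Polynomial.natDegree_X_le⟩
    calc (k - 2 * l) * (C 2 * (C α + C β * X) : ℝ[X]).natDegree ≤ (k - 2 * l) * 1 :=
          Nat.mul_le_mul_left _ h1
      _ ≤ k := by omega
  · intro s
    simp only [gegenbauerSum, eval_finsetSum, eval_mul, eval_pow, eval_C, eval_add, eval_X]

end Poly

end Literature.MathematicalPhysics.QuantumLattice

end
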